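import Summits.AtomisticToContinuum.FouriersLaw.Theses.VanishingNoiseTransfer
import Literature.MathematicalPhysics.KineticTheory.VelocityFlipNoise
import Literature.MathematicalPhysics.KineticTheory.InfiniteChainObservables

/-!
# Line `stieltjes-noise-threshold` — skeleton for crux `VanishingNoiseTransfer.VanishingNoiseBound`
(item stmt-AtomisticToContinuum-11976, rank-3 crux of route `route-AtomisticToContinuum-VanishingNoiseTransfer`;
crux-plan of idea card B `stieltjes-noise-threshold`, triage r1-1 / r1-2 / r1-3: pass / pass / pass,
"merge with `two-channel-leak-criterion`, keep the even-sector constraint, state it in the KLO space,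
add the fixed-ε NESS ≤ Green–Kubo stub")

CRUX (read back from `Theses/VanishingNoiseTransfer.lean`; Disproof §0 `crux_iff_cruxAt`): for
`P = pinnedChain ω₂ lam β γ` (all `> 0`), the inlined flip-steady predicate `S` (`= P.IsFlipSteadyState`
by `rfl`, `isFlipSteadyState_fun_eq`) and every `T > 0`: `∃ K, ε₁ > 0` such that for every
`ε ∈ (0, ε₁]`, the unique flip-steady family at rate `ε`, every response sequence `D_N(ε)` at `T` and
every limit `k = lim_N D_N(ε)`: `k ≤ K` — the noisy conductivities stay bounded as the noise vanishes.

THE LINE (card B as reconstructed by the three triagers — the card file itself lives in the gate evidence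
store, not mounted in this seat; see the line card `Lines/stieltjes-noise-threshold.md`, §Access).
Avellaneda–Majda transplant: `ε ↦ T²κ_ε` is `ε × (a Stieltjes function of ε²)`,
`T²κ_ε^{GK} = ε ∫ dν(t)/(ε² + t)`, `ν` the spectral measure of the CONSTRAINED flip-weighted squared
Liouvillian at the current; `sup_{ε ≤ ε₁} κ_ε < ∞ ⟺ ν[0,r] = O(√r)` at threshold
(`TriageR13Cores.sqrt_law_of_uniform_stieltjes_bound` = the tauberian half) `⟺` ONE ε-free inequality —
FLIP UNCERTAINTY: `≪j,f≫² ≤ C ‖f‖_M ‖𝒜f‖_{M⁻¹}` ("an observable radiating at rate ρ overlaps the current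
by at most C√ρ").  This skeleton states that chain WITHOUT spectral measures and without suprema
(no junk `sSup`): every functional is an explicit KLO pairing
`≪f,g≫_μ = ∑_{x∈ℤ} Cov_μ(f, g∘τ_x)` (trap T2 of triage r1-3: the conductivity lives in the
Kipnis–Landim–Olla space, where spatial coboundaries are null) of LOCAL test functions
(`IsLocalTestFunction`, Bernardin's `C₀¹`) under an infinite-volume Gibbs state `μ` of `P` at `T`, and the
dual norm of the radiation `𝒜f` enters only through its Legendre minorants
`Φ^θ(f,h) = 2≪𝒜f,h≫ − ≪h,−Sh≫ − θ≪h,h≫` (`sup_h Φ^θ(f,h) = ‖𝒜f‖²_{(θ+M)⁻¹}`): the odd sectors of `𝒜f` are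
weighted by `(θ + 2|W|)⁻¹` and its momentum-EVEN part — the LEAK, which the flips do not damp — by the
FINITE weight `θ⁻¹`, `θ > 0` chosen by the prover of stub 3 (trap T1 of triage r1-2 in r1-1's precise
form: weight zero on the leak would make the line false at `f = j`, weight `+∞` — the exact KLO constraint —
would let the sup over LOCAL test functions see only the rigid class of exactly leak-free observables and
would make stub 4 false; any finite positive weight is admissible for the SUFFICIENT direction and passes
to the `λ ↓ 0` limit: for `λ ≤ θε`, `(λ + εM)⁻¹ ≥ (ε(θ+M))⁻¹`).  Objects (`§ Vocabulary`): `flipZ`, `shiftBy`,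
`flipDefect` (`−S`), `klo`, `overlap` (`t(f) = ≪j₀,f≫`), `dirichlet` (`a(f) = ≪f,−Sf≫`), `radiation`
(`Φ^θ(f,h)`), `value` (`2t(f) − εa(f) − Φ^θ(f,h)/ε`, whose `sup_f inf_h` is the regularised variational
conductivity `𝒱^θ(ε) ≥ σ_λ(ε)` for all `λ ≤ θε`, hence `≥ T²κ_ε^{GK}`).

REGISTERED STUBS (4; shape of `Cruxes/NoiseLocality/Lines/fekete-transposed-uniformity.lean`:
`theorem Holds.stub_<name> : <statement> := by sorry` + handle `def stub_<name> : Prop := type_of% …`):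
* `stub_flipGibbsState` (L) — an infinite-volume Gibbs state of `P` at `T` exists which is shift- and
  flip-invariant (DLR existence for the 1-D chain with superstable quartic potentials; momenta are
  i.i.d. Gaussian given the positions).  Supplies the `μ` the other three stubs quantify over.
* `stub_currentStaticBound` (M/L) — KLO statics: `0 ≤ a(f)` and `t(f)² ≤ C₀·a(f)` for local `f`
  (positivity of the flip Dirichlet form in the KLO space; `j ⊥ even sector`, `−S ≥ 2` off the even
  sector, `C₀ = ½≪j,j≫ < ∞`).  This stub ALONE gives Bernardin–Olla's `κ_ε ≤ C₀/(εT²)` line (Prop. 4);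
  in the composition it settles the FAST cone (observables radiating at rate `> r₀`).
* `stub_slowConeUncertainty` (XL, HARDEST — the crux's content in ε-free form) — for some `θ, r₀ > 0`, on
  the SLOW cone `{f : Φ^θ(f,h) ≤ r₀ a(f) ∀h}` (observables whose radiation — leak weighted by `θ⁻¹` — is at
  most `r₀` times their flip size): `t(f)² ≤ C √a(f) √(Φ^θ(f,h) + η)` for some local `h` (every `η > 0`).
  EQUIVALENT, given stub 2, to `sup_{ε∈(0,1]} 𝒱^θ(ε) < ∞` (`§ Remarks`: `uncertainty_of_bounded_value`
  proves the converse of the ε-collapse): a relocation of X2 into ONE equilibrium inequality for ONE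
  antisymmetric operator, in its robust SUFFICIENT form (`𝒱^θ ≥ 𝒱^{0⁺} = T²κ^{GK}`; triage r1-3's doubt
  "the Transfer is an equivalence" holds verbatim at `θ = 0⁺` in the completed space).  Fails, as it must,
  in the harmonic corner (`Q₁ = ∑ p_x(q_{x+1} − q_{x−1})` is conserved, leak-free and overlaps `j`:
  `inv_law_of_conserved_witness` + Disproof §4 `cruxAt_false_harmonic`), and under any flip-NON-invariant
  local charge (Mazur).
* `stub_nessLeVariational` (XL at FIXED ε; trap T3) — for every `θ > 0` and each `ε ∈ (0,1]`: if every local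
  `f` admits a local `h` with `value θ ε f h ≤ K`, then every limit `k` of responses of the unique
  flip-steady family at rate `ε` obeys `k ≤ c·K + c'` (`c, c'` depend on parameters, `T`, `μ` only).
  Content: (a) open-chain NESS conductivity `≤` infinite-volume Green–Kubo conductivity
  `T⁻² lim_{λ↓0} σ_λ(ε)` of `𝒜 + εS` (unprinted for anharmonic chains, BO2011 p.3; the limit exists, BO2011
  Thm 2); (b) `σ_λ(ε) ≤ 𝒱^θ(ε)` for `λ ≤ θε` — the EASY direction of the variational formula BO2011
  eq. (var) at `λ > 0` (valid once `𝒜 + εS` generates a Markov semigroup on the KLO space; core density of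
  `C₀¹`).  POINTWISE in ε: imports no uniformity (Disproof §2 `cruxPointwiseAt_holds` is respected — all
  uniformity comes from stub 3 through the AM–GM collapse proved below).

COMPOSITION `VanishingNoiseBound_of` (SORRY-FREE; axioms propext / Classical.choice / Quot.sound):
`subst` the `S`-binding (Disproof §3 `crux_false_without_SBinding`: the flip-steady EQUATION is used — inside
stub 4), take `μ, C₀, (θ, r₀, C), (c, c')` from stubs 1–4, put `K := C/2 + 1 + C₀/(2√r₀)`, `ε₁ := 1`,
`K_crux := c·K + c'`; for `ε ∈ (0,1]` feed stub 4 with the premise proved test function by test function: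
slow cone & `t(f) = 0` → `h := 0` (`value = −εa(f) ≤ 0`); slow cone & `t(f) ≠ 0` → the `h` of stub 3 with
`η := ε` and `slow_core` (AM–GM `εs² + u²/ε ≥ 2su ≥ 2t²/C`, then `2t − 2t²/C ≤ C/2`); fast cone → the
witness `h` of fastness and `fast_core` (`εa + r₀a/ε ≥ 2√r₀·a ≥ 2√r₀t²/C₀`).  `0 < T` is used by every
stub (Gibbs state at `T`; Disproof §3 `cruxAt_zero_false_of_exists_unique`).
-/

noncomputable section

namespace Summit.AtomisticToContinuum.FouriersLaw.Cruxes.VanishingNoiseBound.StieltjesNoiseThreshold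

open MeasureTheory Filter Topology
open Literature.MathematicalPhysics.KineticTheory.HeatConduction

/-! ## Vocabulary: flips, shifts and KLO pairings on the infinite chain `ChainConfig = ℤ → ℝ × ℝ` -/

/-- The single-site momentum flip `θ^y` of the infinite chain: `(θ^y σ)_y = (q_y, −p_y)`, other sites
unchanged (infinite-volume twin of `momentumFlip`). -/
def flipZ (y : ℤ) (σ : ChainConfig) : ChainConfig :=
  Function.update σ y ((σ y).1, -(σ y).2)

/-- The shift by `x ∈ ℤ`: `(τ_x σ)_z = σ_{z+x}` (`shiftBy 1 = shift`). -/
def shiftBy (x : ℤ) (σ : ChainConfig) : ChainConfig := fun z => σ (z + x)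

/-- The flip NUMBER operator `−S f = ∑_{y∈ℤ} (f − f∘θ^y)` (Bernardin–Olla's `S f = ∑_y (f∘θ^y − f)` with
flips at every site; a finite sum for local `f`, written as a `tsum`).  On functions odd in exactly the
momenta of a finite set `W` it acts as `2|W|`. -/
def flipDefect (f : ChainConfig → ℝ) (σ : ChainConfig) : ℝ :=
  ∑' y : ℤ, (f σ - f (flipZ y σ))

/-- The Kipnis–Landim–Olla pairing `≪f, g≫_μ = ∑_{x∈ℤ} Cov_μ(f, g ∘ τ_x)` (Bernardin–Olla 2011 §3; for a
shift-invariant `μ` with summable covariances it is the density limit `lim |Λ|⁻¹ Cov_μ(∑_{x∈Λ} f∘τ_x,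
∑_{x∈Λ} g∘τ_x)`; spatial coboundaries `g∘τ₁ − g` are `≪·,·≫`-null). -/
def klo (μ : Measure ChainConfig) (f g : ChainConfig → ℝ) : ℝ :=
  ∑' x : ℤ, ((∫ σ, f σ * g (shiftBy x σ) ∂μ) - (∫ σ, f σ ∂μ) * (∫ σ, g σ ∂μ))

/-- OVERLAP with the current: `t(f) = ≪j₀, f≫_μ`, `j₀ = −½(p₀ + p₁)V′(q₁ − q₀)` (`bondCurrentZ · 0`). -/
def overlap (P : OscillatorChain) (μ : Measure ChainConfig) (f : ChainConfig → ℝ) : ℝ :=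
  klo μ (fun σ => P.bondCurrentZ σ 0) f

/-- Flip DIRICHLET form `a(f) = ≪f, −S f≫_μ` (`= ∑_W 2|W| ‖f_W‖²` over flip-parity sectors; the even
sector costs nothing). -/
def dirichlet (μ : Measure ChainConfig) (f : ChainConfig → ℝ) : ℝ :=
  klo μ f (flipDefect f)

/-- RADIATION pairing with leak weight `θ⁻¹`:  `Φ^θ(f, h) = 2≪𝒜f, h≫_μ − a(h) − θ≪h, h≫_μ`, `𝒜 = liouvilleZ P` the
Liouvillian.  Its supremum over `h` is the squared `(θ + M)⁻¹`-norm `‖𝒜f‖²_{(θ+M)⁻¹}` of the radiation of `f`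
(Legendre duality; `M = −S`): the odd sectors of `𝒜f` are weighted by `(θ + 2|W|)⁻¹`, and the momentum-EVEN
part of `𝒜f` (the LEAK, undamped by the flips) by the FINITE weight `θ⁻¹` — for even `h`, `a(h) = 0` and
`Φ^θ(f, λh) = 2λ≪𝒜f,h≫ − θλ²≪h,h≫ ≤ ≪𝒜f,h≫²/(θ≪h,h≫)`.  As `θ ↓ 0` this is the even-sector CONSTRAINT of
the Kipnis–Landim–Olla formula (triage r1-2 trap T1); a finite positive `θ` is the robust SUFFICIENT form
(triage r1-1 §3: "any finite positive weight on the leak is admissible for the sufficient direction and is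
what lets the criterion pass to the `λ ↓ 0` limit without a closedness argument") — with weight zero the
line would be false at `f = j`, with weight `+∞` the sup over LOCAL test functions would see only the
rigid class of exactly leak-free local observables (see stub 4). -/
def radiation (P : OscillatorChain) (μ : Measure ChainConfig) (θ : ℝ) (f h : ChainConfig → ℝ) : ℝ :=
  2 * klo μ (liouvilleZ P f) h - dirichlet μ h - θ * klo μ h h

/-- The VARIATIONAL VALUE at flip rate `ε` (leak weight `θ⁻¹`) of the pair `(f, h)`:
`2 t(f) − ε a(f) − ε⁻¹ Φ^θ(f, h)`.  `𝒱^θ(ε) := sup_f inf_h value` dominates, for every `λ ≤ θε`, the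
resolvent form `σ_λ(ε) = ≪j, (λ − 𝒜 − εS)⁻¹ j≫ = sup_f {2≪j,f≫ − λ≪f,f≫ − εa(f) − ‖𝒜f‖²_{(λ+εM)⁻¹}}`
(Bernardin–Olla 2011 eq. (var), Sethuraman 2000), because `(λ + εM)⁻¹ ≥ (ε(θ + M))⁻¹`; hence
`T²κ_ε^{GK} = lim_{λ↓0} σ_λ(ε) ≤ 𝒱^θ(ε)` (Bernardin–Olla 2011 Thm 2 for the existence of the limit). -/
def value (P : OscillatorChain) (μ : Measure ChainConfig) (θ ε : ℝ) (f h : ChainConfig → ℝ) : ℝ :=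
  2 * overlap P μ f - ε * dirichlet μ f - ε⁻¹ * radiation P μ θ f h

/-! ## Registered stubs (the lemmas of the line; `sorry` only here) -/

/-- **Stub 1 — `stub_flipGibbsState` (size L).**  For `pinnedChain ω₂ lam β γ` (all `> 0`) and `T > 0`
there is an infinite-volume Gibbs state `μ` at temperature `T` (DLR, `IsChainGibbsMeasure`) which is
shift-invariant and invariant under every single-site momentum flip `θ^y`.  Print-level: existence of
(tempered) Gibbs states for one-dimensional systems of unbounded spins with superstable nearest-neighbour
interaction (Ruelle 1976 superstability estimates; Lanford–Lebowitz–Lieb 1977 §4 condition B2; transfer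
operator of the 1-D chain); flip invariance because, given the positions, the momenta are i.i.d.
`N(0,T)` under every DLR state (the specification's kernels factorise).  Not in the tree (only the
scaling equivalences `exists_isChainGibbsMeasure_iff_unit_temp`). -/
theorem Holds.stub_flipGibbsState :
    ∀ ω₂ lam β γ : ℝ, 0 < ω₂ → 0 < lam → 0 < β → 0 < γ → ∀ T : ℝ, 0 < T →
      ∃ μ : Measure ChainConfig,
        (pinnedChain ω₂ lam β γ).IsChainGibbsMeasure T μ ∧ IsShiftInvariant μ ∧
          ∀ y : ℤ, MeasurePreserving (flipZ y) μ μ := by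
  sorry

/-- **Stub 2 — `stub_currentStaticBound` (size M/L; KLO statics).**  For every shift- and flip-invariant
Gibbs state `μ` of `pinnedChain ω₂ lam β γ` at `T > 0` there is `C₀ > 0` with, for every local test
function `f` (`IsLocalTestFunction`): `0 ≤ a(f)` and `t(f)² ≤ C₀ · a(f)`.  Mechanism: in the density
limit `≪f,−Sf≫ = lim |Λ|⁻¹⟨F_Λ, −S F_Λ⟩ = lim |Λ|⁻¹ ∑_W 2|W|‖(F_Λ)_W‖² ≥ 2 lim |Λ|⁻¹‖(1 − P_even)F_Λ‖²`,
while `Cov(J_Λ, F_Λ) = ⟨J_Λ, (1 − P_even)F_Λ⟩` (`J_Λ = ∑ j_x` is orthogonal to the even sector), so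
Cauchy–Schwarz gives `C₀ = ½≪j,j≫ = ½(Var j₀ + 2 Cov(j₀,j₁))` (finite: `Cov(j₀, j_x) = 0` for `|x| ≥ 2`).
Needs: absolute summability of `x ↦ Cov_μ(f, g∘τ_x)` for local `f, g`, `j₀`, `𝒜f` (decay of correlations
of the 1-D Gibbs chain), and the density-limit representation of `klo`.  By itself this stub yields only
the `O(1/ε)` line `κ_ε ≤ C₀/(εT²)` (Bernardin–Olla 2011 Prop. 4) — it HOLDS in the harmonic corner. -/
theorem Holds.stub_currentStaticBound :
    ∀ ω₂ lam β γ : ℝ, 0 < ω₂ → 0 < lam → 0 < β → 0 < γ → ∀ T : ℝ, 0 < T →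
      ∀ μ : Measure ChainConfig,
        (pinnedChain ω₂ lam β γ).IsChainGibbsMeasure T μ → IsShiftInvariant μ →
        (∀ y : ℤ, MeasurePreserving (flipZ y) μ μ) →
        ∃ C₀ : ℝ, 0 < C₀ ∧ ∀ f : ChainConfig → ℝ, IsLocalTestFunction f →
          0 ≤ dirichlet μ f ∧ (overlap (pinnedChain ω₂ lam β γ) μ f) ^ 2 ≤ C₀ * dirichlet μ f := by
  sorry

/-- **Stub 3 — `stub_slowConeUncertainty` (size XL; HARDEST; the content of X2 in ε-free form).**
For every shift- and flip-invariant Gibbs state `μ` of `pinnedChain ω₂ lam β γ` at `T > 0` there are a leak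
weight `θ > 0`, a rate `r₀ > 0` and `C > 0` such that for every local test function `f` in the SLOW CONE —
`Φ^θ(f,h) ≤ r₀·a(f)` for all local `h`, i.e. `‖𝒜f‖²_{(θ+M)⁻¹} ≤ r₀‖f‖²_M`: `f` radiates (odd sectors
weighted by `(θ+2|W|)⁻¹`, even leak by `θ⁻¹`) at rate at most `r₀` — and every `η > 0` there is a local
`h` with `t(f)² ≤ C · √a(f) · √(Φ^θ(f,h) + η)`:  THE OVERLAP OF A SLOWLY RADIATING OBSERVABLE WITH THE
CURRENT IS AT MOST `C^{1/2} ×` (flip size)^{1/2} `×` (radiation)^{1/4} — quantitative absence of slow odd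
modes correlated with the energy current.  Spectral reading (card B): `ν[0,r] ≤ C'√r` for the spectral
measure at `M^{−1/2}j` of `BᵀB`, `B = (θ+M)^{−1/2}𝒜M^{−1/2}`; in the diffusive scenario the threshold
density is `∼ c·t^{−1/2}` with `c ∝ T²κ(0)`, so the exponent `½` is critical (any `r^{1/2+δ}` law would
give `κ_ε → 0`, which NoiseLocality + `closes` exclude).  Equivalent, given stub 2, to
`sup_{ε∈(0,1]} 𝒱^θ(ε) < ∞` (`uncertainty_of_bounded_value` below + `variational_premise_of_uncertainty`):
the robust SUFFICIENT form of card B's FlipUncertainty (`θ = 0⁺`, completed space, is the form equivalent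
to bounded `κ^{GK}`; triage r1-1 §3 / r1-3 T1).  Sufficient route one level down (merge partner, card C
`two-channel-leak-criterion`): the level-one two-channel criterion `(C⋆_loc)` gives an explicit local `h`
(even leak + two-site minorant).  Fails in the harmonic corner `lam = β = 0` (`Q₁ = ∑ p_x(q_{x+1} − q_{x−1})`
is conserved, leak-free, `≪j,Q₁≫ ≠ 0`: `inv_law_of_conserved_witness`) and under a flip-non-invariant local
conserved quantity (Mazur/Drude atom, Disproof §4 `cruxAt_false_of_inv_lower_bound`) — consistent with
`0 < lam`, `0 < β` being load-bearing. -/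
theorem Holds.stub_slowConeUncertainty :
    ∀ ω₂ lam β γ : ℝ, 0 < ω₂ → 0 < lam → 0 < β → 0 < γ → ∀ T : ℝ, 0 < T →
      ∀ μ : Measure ChainConfig,
        (pinnedChain ω₂ lam β γ).IsChainGibbsMeasure T μ → IsShiftInvariant μ →
        (∀ y : ℤ, MeasurePreserving (flipZ y) μ μ) →
        ∃ θ r₀ C : ℝ, 0 < θ ∧ 0 < r₀ ∧ 0 < C ∧ ∀ f : ChainConfig → ℝ, IsLocalTestFunction f →
          (∀ h : ChainConfig → ℝ, IsLocalTestFunction h →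
              radiation (pinnedChain ω₂ lam β γ) μ θ f h ≤ r₀ * dirichlet μ f) →
          ∀ η : ℝ, 0 < η → ∃ h : ChainConfig → ℝ, IsLocalTestFunction h ∧
            (overlap (pinnedChain ω₂ lam β γ) μ f) ^ 2 ≤
              C * Real.sqrt (dirichlet μ f) *
                Real.sqrt (radiation (pinnedChain ω₂ lam β γ) μ θ f h + η) := by
  sorry

/-- **Stub 4 — `stub_nessLeVariational` (size XL at FIXED ε; trap T3 "GK vs NESS").**  For every
shift- and flip-invariant Gibbs state `μ` of `P = pinnedChain ω₂ lam β γ` at `T > 0` there are constants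
`c > 0`, `c' ≥ 0` such that for every leak weight `θ > 0`, every rate `ε ∈ (0,1]` and every `K`: IF every
local test function `f` admits a local `h` with `value P μ θ ε f h ≤ K` (i.e. `𝒱^θ(ε) = sup_f inf_h value
≤ K`), THEN along the unique flip-steady family at rate `ε` every limit `k = lim_N D_N(ε)` of response
coefficients at `T` satisfies `k ≤ c·K + c'` (morally `c = T⁻²`, `c' = 0`).  Two print-level halves, both
at fixed `ε > 0`, neither in the tree: (a) the boundary-driven conductivity of the flip-noisy anharmonic
chain is at most its infinite-volume Green–Kubo conductivity `T⁻² σ₀(ε)`,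
`σ₀(ε) = lim_{λ↓0} ≪j,(λ − 𝒜 − εS)⁻¹j≫` (expected equality; open-chain Kubo formula of Kundu–Dhar–Narayan
2009 + `N → ∞`; the limit exists: Bernardin–Olla 2011 Thm 2; "not able to prove … Fourier's law" for the
anharmonic case, p. 3); (b) `σ_λ(ε) ≤ 𝒱^θ(ε)` for every `λ ∈ (0, θε]` — the EASY direction of the
sup-variational formula, Bernardin–Olla 2011 eq. (var) (`σ_λ = sup_f {2≪j,f≫ − λ≪f,f≫ − εa(f) −
‖𝒜f‖²_{(λ+εM)⁻¹}}`, Sethuraman 2000), since `(λ + εM)⁻¹ ≥ (ε(θ+M))⁻¹`, plus density of the core `C₀¹` in the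
`λ`-form norm (no constraint at `θ > 0`, so no closedness issue); (var) is printed under "`𝒜 + γS` generates
a strongly continuous Markov process on the KLO space", proved for `V″` bounded, expected in general —
for the quartic `pinnedChain` the infinite-volume noisy equilibrium dynamics is itself part of this stub.
Pointwise in `ε`: no uniformity is asked or produced here (Disproof §2 `cruxPointwiseAt_holds`).  Uses
the flip-steady EQUATION `∫ (L + εS)g dν = 0` (Disproof §3 `crux_false_without_SBinding`) and `0 < T`
(§3 `cruxAt_zero_false_of_exists_unique`). -/
theorem Holds.stub_nessLeVariational :
    ∀ ω₂ lam β γ : ℝ, 0 < ω₂ → 0 < lam → 0 < β → 0 < γ → ∀ T : ℝ, 0 < T →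
      ∀ μ : Measure ChainConfig,
        (pinnedChain ω₂ lam β γ).IsChainGibbsMeasure T μ → IsShiftInvariant μ →
        (∀ y : ℤ, MeasurePreserving (flipZ y) μ μ) →
        ∃ c c' : ℝ, 0 < c ∧ 0 ≤ c' ∧ ∀ θ : ℝ, 0 < θ → ∀ ε : ℝ, 0 < ε → ε ≤ 1 → ∀ K : ℝ,
          (∀ f : ChainConfig → ℝ, IsLocalTestFunction f →
              ∃ h : ChainConfig → ℝ, IsLocalTestFunction h ∧
                value (pinnedChain ω₂ lam β γ) μ θ ε f h ≤ K) →
          ∀ ν : (N : ℕ) → ℝ → ℝ → Measure (PhaseSpace N),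
            (∀ (N : ℕ) (T_L T_R : ℝ), 0 < T_L → 0 < T_R →
              (pinnedChain ω₂ lam β γ).IsFlipSteadyState N T_L T_R ε (ν N T_L T_R) ∧
                ∀ ν' : Measure (PhaseSpace N),
                  (pinnedChain ω₂ lam β γ).IsFlipSteadyState N T_L T_R ε ν' → ν' = ν N T_L T_R) →
            ∀ (D : ℕ → ℝ) (k : ℝ),
              (∀ N : ℕ, Tendsto (fun δ : ℝ =>
                  (pinnedChain ω₂ lam β γ).totalCurrent (ν N (T + δ / 2) (T - δ / 2)) / δ)
                (𝓝[≠] 0) (𝓝 (D N))) →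
              Tendsto D atTop (𝓝 k) → k ≤ c * K + c' := by
  sorry

/-! ### Handles by name (hypotheses of `VanishingNoiseBound_of`) -/

/-- Statement of `Holds.stub_flipGibbsState`, by name. -/
def stub_flipGibbsState : Prop := type_of% Holds.stub_flipGibbsState

/-- Statement of `Holds.stub_currentStaticBound`, by name. -/
def stub_currentStaticBound : Prop := type_of% Holds.stub_currentStaticBound

/-- Statement of `Holds.stub_slowConeUncertainty`, by name. -/
def stub_slowConeUncertainty : Prop := type_of% Holds.stub_slowConeUncertainty

/-- Statement of `Holds.stub_nessLeVariational`, by name. -/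
def stub_nessLeVariational : Prop := type_of% Holds.stub_nessLeVariational

/-! ## Elementary facts about the vocabulary (proved) -/

/-- The zero function is a local test function. -/
theorem isLocalTestFunction_zero : IsLocalTestFunction (fun _ : ChainConfig => (0 : ℝ)) := by
  refine ⟨0, fun _ => 0, contDiff_const, ⟨0, fun _ => by simp⟩, ⟨0, fun y => ?_⟩, ?_⟩
  · simp
  · funext σ; rfl

/-- `≪g, 0≫ = 0`. -/
@[simp] theorem klo_zero_right (μ : Measure ChainConfig) (g : ChainConfig → ℝ) :
    klo μ g (fun _ => 0) = 0 := by
  simp [klo]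

/-- `≪0, g≫ = 0`. -/
@[simp] theorem klo_zero_left (μ : Measure ChainConfig) (g : ChainConfig → ℝ) :
    klo μ (fun _ => 0) g = 0 := by
  simp [klo]

/-- `a(0) = 0`. -/
@[simp] theorem dirichlet_zero (μ : Measure ChainConfig) : dirichlet μ (fun _ => 0) = 0 := by
  simp [dirichlet]

/-- `Φ^θ(f, 0) = 0`: the trivial minorant of `‖𝒜f‖²_{(θ+M)⁻¹}`. -/
@[simp] theorem radiation_zero_right (P : OscillatorChain) (μ : Measure ChainConfig) (θ : ℝ)
    (f : ChainConfig → ℝ) : radiation P μ θ f (fun _ => 0) = 0 := by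
  simp [radiation]

/-- `value θ ε f 0 = 2 t(f) − ε a(f)`. -/
theorem value_zero_right (P : OscillatorChain) (μ : Measure ChainConfig) (θ ε : ℝ)
    (f : ChainConfig → ℝ) :
    value P μ θ ε f (fun _ => 0) = 2 * overlap P μ f - ε * dirichlet μ f := by
  simp [value]

/-! ## The ε-collapse (abstract Avellaneda–Majda / AM–GM core; proved, pure real arithmetic) -/

/-- **Slow-cone core.**  From the uncertainty inequality `t² ≤ C √a √(Φ + ε)` with `t ≠ 0`, the
variational value `2t − εa − Φ/ε` is at most `C/2 + 1` — uniformly in the rate `ε > 0`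
(`εs² + u²/ε ≥ 2su ≥ 2t²/C` with `s = √a`, `u = √(Φ+ε)`, then `2t − 2t²/C ≤ C/2`). -/
theorem slow_core {t a Φ ε C : ℝ} (hε : 0 < ε) (hC : 0 < C) (ha : 0 ≤ a)
    (hUI : t ^ 2 ≤ C * Real.sqrt a * Real.sqrt (Φ + ε)) (ht : t ≠ 0) :
    2 * t - ε * a - ε⁻¹ * Φ ≤ C / 2 + 1 := by
  set s := Real.sqrt a with hs
  set u := Real.sqrt (Φ + ε) with hu
  have hs0 : 0 ≤ s := Real.sqrt_nonneg _
  have hu0 : 0 ≤ u := Real.sqrt_nonneg _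
  have ht2 : 0 < t ^ 2 := by positivity
  have hsu : 0 < s * u := by
    by_contra hcon
    rw [not_lt] at hcon
    have : C * s * u ≤ 0 := by
      have : C * (s * u) ≤ 0 := mul_nonpos_of_nonneg_of_nonpos hC.le hcon
      linarith [mul_assoc C s u]
    linarith
  have hu_pos : 0 < u := by
    rcases lt_or_eq_of_le hu0 with h | h
    · exact h
    · exfalso; rw [← h, mul_zero] at hsu; exact lt_irrefl _ hsu
  have hΦε : 0 < Φ + ε := by
    rwa [hu, Real.sqrt_pos] at hu_pos
  have hu2 : u ^ 2 = Φ + ε := by rw [hu, Real.sq_sqrt hΦε.le]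
  have hs2 : s ^ 2 = a := by rw [hs, Real.sq_sqrt ha]
  have hamgm : 2 * (s * u) ≤ ε * s ^ 2 + ε⁻¹ * u ^ 2 := by
    have h1 : 0 ≤ (ε * s - u) ^ 2 := sq_nonneg _
    have h2 : ε * s ^ 2 + ε⁻¹ * u ^ 2 - 2 * (s * u) = ε⁻¹ * (ε * s - u) ^ 2 := by
      field_simp
      ring
    have h3 : 0 ≤ ε⁻¹ * (ε * s - u) ^ 2 := by positivity
    linarith
  have hsu' : t ^ 2 / C ≤ s * u := by
    rw [div_le_iff₀ hC]
    linarith [mul_assoc C s u, mul_comm (s * u) C]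
  have hquad : 2 * t - 2 * (t ^ 2 / C) ≤ C / 2 := by
    have h1 : 0 ≤ (t - C / 2) ^ 2 := sq_nonneg _
    have h2 : C / 2 - (2 * t - 2 * (t ^ 2 / C)) = (2 / C) * (t - C / 2) ^ 2 := by
      field_simp
      ring
    have h3 : 0 ≤ (2 / C) * (t - C / 2) ^ 2 := by positivity
    linarith
  have hrew : 2 * t - ε * a - ε⁻¹ * Φ = 2 * t - (ε * s ^ 2 + ε⁻¹ * u ^ 2) + 1 := by
    rw [hs2, hu2]
    field_simp
    ring
  rw [hrew]
  linarith

/-- **Fast-cone core.**  From the static bound `t² ≤ C₀ a` and fast radiation `r₀ a < Φ` the variational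
value is at most `C₀/(2√r₀)` — uniformly in `ε > 0` (`εa + r₀a/ε ≥ 2√r₀·a ≥ 2√r₀t²/C₀`). -/
theorem fast_core {t a Φ ε C₀ r₀ : ℝ} (hε : 0 < ε) (hC₀ : 0 < C₀) (hr₀ : 0 < r₀) (ha : 0 ≤ a)
    (hstat : t ^ 2 ≤ C₀ * a) (hfast : r₀ * a < Φ) :
    2 * t - ε * a - ε⁻¹ * Φ ≤ C₀ / (2 * Real.sqrt r₀) := by
  set ρ := Real.sqrt r₀ with hρ
  have hρ0 : 0 < ρ := Real.sqrt_pos.mpr hr₀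
  have hρ2 : ρ ^ 2 = r₀ := by rw [hρ, Real.sq_sqrt hr₀.le]
  have h1 : ε⁻¹ * (r₀ * a) ≤ ε⁻¹ * Φ := by
    have : 0 < ε⁻¹ := by positivity
    exact mul_le_mul_of_nonneg_left hfast.le this.le
  have h2 : 2 * ρ * a ≤ ε * a + ε⁻¹ * (r₀ * a) := by
    have e1 : ε * a + ε⁻¹ * (r₀ * a) - 2 * ρ * a = ε⁻¹ * a * (ε - ρ) ^ 2 := by
      rw [← hρ2]
      field_simp
      ring
    have e2 : 0 ≤ ε⁻¹ * a * (ε - ρ) ^ 2 := by positivity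
    linarith
  have h3 : 2 * ρ * (t ^ 2 / C₀) ≤ 2 * ρ * a := by
    have : t ^ 2 / C₀ ≤ a := by rw [div_le_iff₀ hC₀]; linarith [mul_comm C₀ a]
    exact mul_le_mul_of_nonneg_left this (by positivity)
  have h4 : 2 * t - 2 * ρ * (t ^ 2 / C₀) ≤ C₀ / (2 * ρ) := by
    have e1 : C₀ / (2 * ρ) - (2 * t - 2 * ρ * (t ^ 2 / C₀)) =
        (2 * ρ / C₀) * (t - C₀ / (2 * ρ)) ^ 2 := by
      field_simp
      ring
    have e2 : 0 ≤ (2 * ρ / C₀) * (t - C₀ / (2 * ρ)) ^ 2 := by positivity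
    linarith
  linarith

/-- **The variational premise of stub 4, uniformly in `ε ∈ (0,1]`, from stubs 2 and 3** (at a fixed
state `μ`).  This is the heart of the line: one ε-free inequality on the slow cone plus KLO statics on the
fast cone bound the variational conductivity `𝒱(ε)` by `K := C/2 + 1 + C₀/(2√r₀)` for every rate. -/
theorem variational_premise_of_uncertainty (P : OscillatorChain) (μ : Measure ChainConfig)
    {θ C₀ r₀ C : ℝ} (hC₀ : 0 < C₀) (hr₀ : 0 < r₀) (hC : 0 < C)
    (hstat : ∀ f : ChainConfig → ℝ, IsLocalTestFunction f →
      0 ≤ dirichlet μ f ∧ (overlap P μ f) ^ 2 ≤ C₀ * dirichlet μ f)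
    (hslow : ∀ f : ChainConfig → ℝ, IsLocalTestFunction f →
      (∀ h : ChainConfig → ℝ, IsLocalTestFunction h → radiation P μ θ f h ≤ r₀ * dirichlet μ f) →
      ∀ η : ℝ, 0 < η → ∃ h : ChainConfig → ℝ, IsLocalTestFunction h ∧
        (overlap P μ f) ^ 2 ≤ C * Real.sqrt (dirichlet μ f) * Real.sqrt (radiation P μ θ f h + η))
    {ε : ℝ} (hε : 0 < ε) (_hε1 : ε ≤ 1) :
    ∀ f : ChainConfig → ℝ, IsLocalTestFunction f →
      ∃ h : ChainConfig → ℝ, IsLocalTestFunction h ∧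
        value P μ θ ε f h ≤ C / 2 + 1 + C₀ / (2 * Real.sqrt r₀) := by
  intro f hf
  obtain ⟨ha, ht⟩ := hstat f hf
  have hK₁ : 0 ≤ C / 2 + 1 := by positivity
  have hK₂ : 0 ≤ C₀ / (2 * Real.sqrt r₀) := by positivity
  by_cases hcone : ∀ h : ChainConfig → ℝ, IsLocalTestFunction h →
      radiation P μ θ f h ≤ r₀ * dirichlet μ f
  · -- slow cone
    by_cases ht0 : overlap P μ f = 0
    · refine ⟨fun _ => 0, isLocalTestFunction_zero, ?_⟩
      rw [value_zero_right, ht0]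
      have : 0 ≤ ε * dirichlet μ f := by positivity
      linarith
    · obtain ⟨h, hh, hUI⟩ := hslow f hf hcone ε hε
      refine ⟨h, hh, ?_⟩
      have := slow_core (Φ := radiation P μ θ f h) hε hC ha hUI ht0
      unfold value
      linarith
  · -- fast cone
    simp only [not_forall, not_le, exists_prop] at hcone
    obtain ⟨h, hh, hfast⟩ := hcone
    refine ⟨h, hh, ?_⟩
    have := fast_core hε hC₀ hr₀ ha ht hfast
    unfold value
    linarith

/-! ## The skeleton theorem: the four stubs imply the crux BY NAME (sorry-free) -/

/-- **`VanishingNoiseBound_of`** — `stub_flipGibbsState → stub_currentStaticBound →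
stub_slowConeUncertainty → stub_nessLeVariational → VanishingNoiseTransfer.VanishingNoiseBound`, with
`K_crux = c·(C/2 + 1 + C₀/(2√r₀)) + c'` and `ε₁ = 1`. -/
theorem VanishingNoiseBound_of (h1 : stub_flipGibbsState) (h2 : stub_currentStaticBound)
    (h3 : stub_slowConeUncertainty) (h4 : stub_nessLeVariational) :
    Summit.AtomisticToContinuum.FouriersLaw.Theses.VanishingNoiseTransfer.VanishingNoiseBound := by
  intro ω₂ lam β γ hω hl hβ hγ S hS T hT
  subst hS
  obtain ⟨μ, hG, hSh, hFl⟩ := h1 ω₂ lam β γ hω hl hβ hγ T hT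
  obtain ⟨C₀, hC₀, hstat⟩ := h2 ω₂ lam β γ hω hl hβ hγ T hT μ hG hSh hFl
  obtain ⟨θ, r₀, C, hθ, hr₀, hC, hslow⟩ := h3 ω₂ lam β γ hω hl hβ hγ T hT μ hG hSh hFl
  obtain ⟨c, c', hc, hc', hness⟩ := h4 ω₂ lam β γ hω hl hβ hγ T hT μ hG hSh hFl
  refine ⟨c * (C / 2 + 1 + C₀ / (2 * Real.sqrt r₀)) + c', 1, one_pos, ?_⟩
  intro ε hε hε1 ν hν D k hD hk
  exact hness θ hθ ε hε hε1 _
    (variational_premise_of_uncertainty (pinnedChain ω₂ lam β γ) μ hC₀ hr₀ hC hstat hslow hε hε1)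
    ν hν D k hD hk

/-! ## Remarks (proved): the stub set is calibrated

Two kernel-checked remarks answering the triage panel.  (1) `uncertainty_of_bounded_value` — the CONVERSE
of the ε-collapse: given the statics of stub 2, stub 3 (on the slow cone with `r₀ = 1`) FOLLOWS from
boundedness of `𝒱^θ` on `(0,1]`; so the content stub is EQUIVALENT to "the regularised variational
conductivity `𝒱^θ(ε)` stays bounded as `ε ↓ 0`", neither weaker nor stronger (triage r1-3's finding
`sqrt_law_of_uniform_stieltjes_bound`, here in the sup-free vocabulary of the skeleton).
(2) `inv_law_of_conserved_witness` — the killing shape: an odd local conserved observable overlapping the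
current forces `𝒱^θ(ε) ≥ t²/(εa)`, the `1/ε` law (harmonic corner; Mazur), cf. Disproof §4. -/

/-! ### Homogeneity of the KLO functionals under scaling (for the remarks below) -/

theorem klo_const_mul_left (μ : Measure ChainConfig) (c : ℝ) (f g : ChainConfig → ℝ) :
    klo μ (fun σ => c * f σ) g = c * klo μ f g := by
  unfold klo
  rw [← tsum_mul_left]
  congr 1
  funext x
  have h1 : ∫ σ, c * f σ * g (shiftBy x σ) ∂μ = c * ∫ σ, f σ * g (shiftBy x σ) ∂μ := by
    rw [← integral_const_mul]
    congr 1; funext σ; ring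
  rw [h1, integral_const_mul]
  ring

theorem klo_const_mul_right (μ : Measure ChainConfig) (c : ℝ) (f g : ChainConfig → ℝ) :
    klo μ f (fun σ => c * g σ) = c * klo μ f g := by
  unfold klo
  rw [← tsum_mul_left]
  congr 1
  funext x
  have h1 : ∫ σ, f σ * (c * g (shiftBy x σ)) ∂μ = c * ∫ σ, f σ * g (shiftBy x σ) ∂μ := by
    rw [← integral_const_mul]
    congr 1; funext σ; ring
  rw [h1, integral_const_mul]
  ring

theorem flipDefect_const_mul (c : ℝ) (f : ChainConfig → ℝ) :
    flipDefect (fun σ => c * f σ) = fun σ => c * flipDefect f σ := by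
  funext σ
  unfold flipDefect
  rw [← tsum_mul_left]
  congr 1
  funext y
  ring

theorem dirichlet_const_mul (μ : Measure ChainConfig) (c : ℝ) (f : ChainConfig → ℝ) :
    dirichlet μ (fun σ => c * f σ) = c ^ 2 * dirichlet μ f := by
  unfold dirichlet
  rw [flipDefect_const_mul, klo_const_mul_left, klo_const_mul_right]
  ring

theorem overlap_const_mul (P : OscillatorChain) (μ : Measure ChainConfig) (c : ℝ)
    (f : ChainConfig → ℝ) : overlap P μ (fun σ => c * f σ) = c * overlap P μ f := by
  unfold overlap
  rw [klo_const_mul_right]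

theorem radiation_const_mul (P : OscillatorChain) (μ : Measure ChainConfig) (θ c : ℝ)
    {f : ChainConfig → ℝ} (hf : IsLocalTestFunction f) (h : ChainConfig → ℝ) :
    radiation P μ θ (fun σ => c * f σ) (fun σ => c * h σ) = c ^ 2 * radiation P μ θ f h := by
  unfold radiation
  rw [hf.liouvilleZ_const_mul c P, klo_const_mul_left, klo_const_mul_right, dirichlet_const_mul,
    klo_const_mul_left, klo_const_mul_right]
  ring

/-- `Φ^θ(c f, h) = c² Φ^θ(f, c⁻¹ h)` for `c ≠ 0`. -/
theorem radiation_const_mul_left (P : OscillatorChain) (μ : Measure ChainConfig) (θ : ℝ) {c : ℝ}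
    (hc : c ≠ 0) {f : ChainConfig → ℝ} (hf : IsLocalTestFunction f) (h : ChainConfig → ℝ) :
    radiation P μ θ (fun σ => c * f σ) h = c ^ 2 * radiation P μ θ f (fun σ => c⁻¹ * h σ) := by
  have hh : h = fun σ => c * (c⁻¹ * h σ) := by
    funext σ; field_simp
  conv_lhs => rw [hh]
  exact radiation_const_mul P μ θ c hf _

theorem value_const_mul (P : OscillatorChain) (μ : Measure ChainConfig) (θ ε : ℝ) {c : ℝ}
    (hc : c ≠ 0) {f : ChainConfig → ℝ} (hf : IsLocalTestFunction f) (h : ChainConfig → ℝ) :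
    value P μ θ ε (fun σ => c * f σ) h =
      2 * (c * overlap P μ f) - ε * (c ^ 2 * dirichlet μ f) -
        ε⁻¹ * (c ^ 2 * radiation P μ θ f (fun σ => c⁻¹ * h σ)) := by
  unfold value
  rw [overlap_const_mul, dirichlet_const_mul, radiation_const_mul_left P μ θ hc hf]


/-! ### Arithmetic of the converse ε-collapse -/

theorem conv_stepA {t a K : ℝ} (ha : 0 < a)
    (H' : ∀ c : ℝ, c ≠ 0 → 2 * c * t - c ^ 2 * (1 * a + a / 1) ≤ K) (ht : t ≠ 0) :
    t ^ 2 ≤ 2 * K * a := by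
  have hc : t / (2 * a) ≠ 0 := div_ne_zero ht (by positivity)
  have h := H' (t / (2 * a)) hc
  have e : 2 * (t / (2 * a)) * t - (t / (2 * a)) ^ 2 * (1 * a + a / 1) = t ^ 2 / (2 * a) := by
    field_simp
    ring
  rw [e, div_le_iff₀ (by positivity)] at h
  linarith

theorem conv_stepB {t a K τ : ℝ} (hK : 0 < K) (ha : 0 < a) (ht : t ≠ 0) (hA : t ^ 2 ≤ 2 * K * a)
    (hτ : τ ≤ 0)
    (H : ∀ c : ℝ, c ≠ 0 → ∀ ε : ℝ, 0 < ε → ε ≤ 1 → 2 * c * t - c ^ 2 * (ε * a + τ / ε) < K) :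
    False := by
  have ht2 : 0 < t ^ 2 := by positivity
  set ε := t ^ 2 / (2 * K * a) with hε
  have hε0 : 0 < ε := by positivity
  have hε1 : ε ≤ 1 := by rw [hε, div_le_one (by positivity)]; exact hA
  have hc : K / t ≠ 0 := div_ne_zero hK.ne' ht
  have h := H (K / t) hc ε hε0 hε1
  have e1 : 2 * (K / t) * t = 2 * K := by field_simp
  have e2 : (K / t) ^ 2 * (ε * a) = K / 2 := by
    rw [hε]; field_simp
  have e3 : (K / t) ^ 2 * (τ / ε) ≤ 0 :=
    mul_nonpos_of_nonneg_of_nonpos (sq_nonneg _) (div_nonpos_of_nonpos_of_nonneg hτ hε0.le)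
  have : 2 * (K / t) * t - (K / t) ^ 2 * (ε * a + τ / ε) ≥ 3 * K / 2 := by
    rw [mul_add, e1, e2]
    linarith
  linarith

theorem conv_stepC {t a K τ : ℝ} (hK : 0 < K) (ha : 0 < a) (ht : t ≠ 0) (hA : t ^ 2 ≤ 2 * K * a)
    (hτ : 0 < τ) (hτ0 : τ < t ^ 4 / (4 * K ^ 2 * a))
    (H : ∀ c : ℝ, c ≠ 0 → ∀ ε : ℝ, 0 < ε → ε ≤ 1 → 2 * c * t - c ^ 2 * (ε * a + τ / ε) < K) :
    False := by
  have ht2 : 0 < t ^ 2 := by positivity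
  -- τ < a
  have hτa : τ < a := by
    have h1 : t ^ 4 / (4 * K ^ 2 * a) ≤ a := by
      rw [div_le_iff₀ (by positivity)]
      have : t ^ 4 = (t ^ 2) ^ 2 := by ring
      rw [this]
      have h2 : (t ^ 2) ^ 2 ≤ (2 * K * a) ^ 2 := pow_le_pow_left₀ ht2.le hA 2
      nlinarith
    linarith
  set ρ := Real.sqrt (τ * a) with hρ
  have hρ0 : 0 < ρ := Real.sqrt_pos.mpr (by positivity)
  have hρ2 : ρ ^ 2 = τ * a := by rw [hρ, Real.sq_sqrt (by positivity)]
  set ε := ρ / a with hε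
  have hε0 : 0 < ε := by positivity
  have hε1 : ε ≤ 1 := by
    rw [hε, div_le_one ha, hρ]
    calc Real.sqrt (τ * a) ≤ Real.sqrt (a * a) := Real.sqrt_le_sqrt (by nlinarith)
      _ = a := Real.sqrt_mul_self ha.le
  have hc : t / (2 * ρ) ≠ 0 := div_ne_zero ht (by positivity)
  have h := H (t / (2 * ρ)) hc ε hε0 hε1
  have e1 : ε * a = ρ := by rw [hε]; field_simp
  have e2 : τ / ε = ρ := by
    rw [hε]
    field_simp
    linarith [hρ2]
  rw [e1, e2] at h
  have e3 : 2 * (t / (2 * ρ)) * t - (t / (2 * ρ)) ^ 2 * (ρ + ρ) = t ^ 2 / (2 * ρ) := by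
    field_simp
    ring
  rw [e3, div_lt_iff₀ (by positivity)] at h
  -- t² < 2Kρ ⇒ t⁴ < 4K²τa ⇒ contradiction with hτ0
  have h4 : t ^ 4 < 4 * K ^ 2 * (τ * a) := by
    have hpos : 0 < K * (2 * ρ) := by positivity
    have : (t ^ 2) ^ 2 < (K * (2 * ρ)) ^ 2 := pow_lt_pow_left₀ h ht2.le two_ne_zero
    calc t ^ 4 = (t ^ 2) ^ 2 := by ring
      _ < (K * (2 * ρ)) ^ 2 := this
      _ = 4 * K ^ 2 * ρ ^ 2 := by ring
      _ = 4 * K ^ 2 * (τ * a) := by rw [hρ2]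
  have h5 : t ^ 4 / (4 * K ^ 2 * a) < τ := by
    rw [div_lt_iff₀ (by positivity)]
    linarith
  linarith

/-- **Converse of the ε-collapse** (stub 3 is NOT stronger than "`𝒱^θ` bounded on `(0,1]`", given the
statics of stub 2): if every local `f` admits a local `h` with `value θ ε f h ≤ K` for every `ε ∈ (0,1]`
(one `K > 0`), and `0 ≤ a(f)`, `t(f)² ≤ C₀ a(f)`, then on the slow cone `{Φ^θ(f,·) ≤ a(f)}` (`r₀ = 1`) the
uncertainty inequality holds with constant `2K`. -/
theorem uncertainty_of_bounded_value (P : OscillatorChain) (μ : Measure ChainConfig) {θ K C₀ : ℝ}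
    (hK : 0 < K)
    (hstat : ∀ f : ChainConfig → ℝ, IsLocalTestFunction f →
      0 ≤ dirichlet μ f ∧ (overlap P μ f) ^ 2 ≤ C₀ * dirichlet μ f)
    (hbound : ∀ ε : ℝ, 0 < ε → ε ≤ 1 → ∀ f : ChainConfig → ℝ, IsLocalTestFunction f →
      ∃ h : ChainConfig → ℝ, IsLocalTestFunction h ∧ value P μ θ ε f h ≤ K) :
    ∀ f : ChainConfig → ℝ, IsLocalTestFunction f →
      (∀ h : ChainConfig → ℝ, IsLocalTestFunction h → radiation P μ θ f h ≤ dirichlet μ f) →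
      ∀ η : ℝ, 0 < η → ∃ h : ChainConfig → ℝ, IsLocalTestFunction h ∧
        (overlap P μ f) ^ 2 ≤
          2 * K * Real.sqrt (dirichlet μ f) * Real.sqrt (radiation P μ θ f h + η) := by
  intro f hf hslow η hη
  obtain ⟨ha, hta⟩ := hstat f hf
  set t := overlap P μ f with ht_def
  set a := dirichlet μ f with ha_def
  by_cases ht : t = 0
  · refine ⟨fun _ => 0, isLocalTestFunction_zero, ?_⟩
    rw [ht]
    have : 0 ≤ 2 * K * Real.sqrt a * Real.sqrt (radiation P μ θ f (fun _ => 0) + η) := by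
      positivity
    simpa using this
  -- t ≠ 0, hence a > 0
  have ha_pos : 0 < a := by
    rcases lt_or_eq_of_le ha with h | h
    · exact h
    · exfalso; apply ht
      have : t ^ 2 ≤ 0 := by rw [← h] at hta; simpa using hta
      exact pow_eq_zero_iff two_ne_zero |>.mp (le_antisymm this (sq_nonneg t))
  by_contra hno
  have hno' : ∀ h : ChainConfig → ℝ, IsLocalTestFunction h →
      2 * K * Real.sqrt a * Real.sqrt (radiation P μ θ f h + η) < t ^ 2 := by
    intro h hh
    by_contra hle
    exact hno ⟨h, hh, not_lt.mp hle⟩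
  -- every local h radiates less than τ₀ − η, τ₀ := t⁴/(4K²a)
  set τ₀ := t ^ 4 / (4 * K ^ 2 * a) with hτ₀
  have hτ₀pos : 0 < τ₀ := by positivity
  have hΦ : ∀ h : ChainConfig → ℝ, IsLocalTestFunction h → radiation P μ θ f h < τ₀ - η := by
    intro h hh
    have h1 := hno' h hh
    by_cases hneg : radiation P μ θ f h + η < 0
    · linarith
    · rw [not_lt] at hneg
      -- (2K√a)²(Φ+η) < t⁴
      have hsq : (2 * K * Real.sqrt a * Real.sqrt (radiation P μ θ f h + η)) ^ 2 < (t ^ 2) ^ 2 :=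
        pow_lt_pow_left₀ h1 (by positivity) two_ne_zero
      have e : (2 * K * Real.sqrt a * Real.sqrt (radiation P μ θ f h + η)) ^ 2 =
          4 * K ^ 2 * a * (radiation P μ θ f h + η) := by
        rw [mul_pow, mul_pow, mul_pow, Real.sq_sqrt ha, Real.sq_sqrt hneg]; ring
      rw [e] at hsq
      have : radiation P μ θ f h + η < τ₀ := by
        rw [hτ₀, lt_div_iff₀ (by positivity)]
        calc (radiation P μ θ f h + η) * (4 * K ^ 2 * a)
            = 4 * K ^ 2 * a * (radiation P μ θ f h + η) := by ring
          _ < (t ^ 2) ^ 2 := hsq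
          _ = t ^ 4 := by ring
      linarith
  -- the scaled bounds
  have H : ∀ c : ℝ, c ≠ 0 → ∀ ε : ℝ, 0 < ε → ε ≤ 1 →
      2 * c * t - c ^ 2 * (ε * a + (τ₀ - η) / ε) < K := by
    intro c hc ε hε hε1
    obtain ⟨h, hh, hv⟩ := hbound ε hε hε1 _ (hf.const_mul c)
    rw [value_const_mul P μ θ ε hc hf] at hv
    have hlt := hΦ _ (hh.const_mul c⁻¹)
    have hc2 : 0 < c ^ 2 * ε⁻¹ := by positivity
    have key : c ^ 2 * ε⁻¹ * radiation P μ θ f (fun σ => c⁻¹ * h σ) < c ^ 2 * ε⁻¹ * (τ₀ - η) :=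
      mul_lt_mul_of_pos_left hlt hc2
    have e : (τ₀ - η) / ε = ε⁻¹ * (τ₀ - η) := by rw [div_eq_inv_mul]
    rw [e]
    nlinarith [key, hv]
  have H' : ∀ c : ℝ, c ≠ 0 → 2 * c * t - c ^ 2 * (1 * a + a / 1) ≤ K := by
    intro c hc
    obtain ⟨h, hh, hv⟩ := hbound 1 one_pos le_rfl _ (hf.const_mul c)
    rw [value_const_mul P μ θ 1 hc hf] at hv
    have hle := hslow _ (hh.const_mul c⁻¹)
    have hc2 : 0 ≤ c ^ 2 := sq_nonneg _
    have key : c ^ 2 * radiation P μ θ f (fun σ => c⁻¹ * h σ) ≤ c ^ 2 * a :=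
      mul_le_mul_of_nonneg_left hle hc2
    simp only [inv_one, one_mul, div_one] at hv ⊢
    nlinarith [key, hv]
  have hA := conv_stepA ha_pos H' ht
  by_cases hτ : τ₀ - η ≤ 0
  · exact conv_stepB hK ha_pos ht hA hτ H
  · exact conv_stepC hK ha_pos ht hA (not_le.mp hτ) (by linarith) H

/-- **The killing shape in this vocabulary (Drude atom / Mazur).**  A local observable `f` overlapping
the current (`t(f) ≠ 0`, `a(f) > 0`) which does not radiate at all — `Φ^θ(f,h) ≤ 0` for every local `h`,
i.e. `𝒜f` is KLO-null in every sector, leak included: an odd local conserved quantity modulo coboundaries —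
forces `𝒱^θ(ε) ≥ t(f)²/(ε a(f))`: the premise of stub 4 can only hold with `K ≥ t²/(εa)`, the `1/ε` law of
the harmonic corner (`Q₁ = ∑ p_x(q_{x+1} − q_{x−1})`) and of Mazur's bound (Disproof §4
`cruxAt_false_of_inv_lower_bound`; the NESS ≥ GK direction needed to turn this into `¬ VanishingNoiseBound`
is not part of this line). -/
theorem inv_law_of_conserved_witness (P : OscillatorChain) (μ : Measure ChainConfig) {θ ε K : ℝ}
    (hε : 0 < ε) {f : ChainConfig → ℝ} (hf : IsLocalTestFunction f)
    (hcons : ∀ h : ChainConfig → ℝ, IsLocalTestFunction h → radiation P μ θ f h ≤ 0)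
    (ht : overlap P μ f ≠ 0) (ha : 0 < dirichlet μ f)
    (hprem : ∀ f' : ChainConfig → ℝ, IsLocalTestFunction f' →
      ∃ h : ChainConfig → ℝ, IsLocalTestFunction h ∧ value P μ θ ε f' h ≤ K) :
    (overlap P μ f) ^ 2 / (ε * dirichlet μ f) ≤ K := by
  set t := overlap P μ f
  set a := dirichlet μ f
  set c := t / (ε * a) with hc_def
  have hc : c ≠ 0 := div_ne_zero ht (by positivity)
  obtain ⟨h, hh, hv⟩ := hprem _ (hf.const_mul c)
  rw [value_const_mul P μ θ ε hc hf] at hv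
  have hΦ := hcons _ (hh.const_mul c⁻¹)
  have h1 : ε⁻¹ * (c ^ 2 * radiation P μ θ f (fun σ => c⁻¹ * h σ)) ≤ 0 :=
    mul_nonpos_of_nonneg_of_nonpos (by positivity)
      (mul_nonpos_of_nonneg_of_nonpos (sq_nonneg _) hΦ)
  have h2 : 2 * (c * t) - ε * (c ^ 2 * a) ≤ K := by linarith
  have e : 2 * (c * t) - ε * (c ^ 2 * a) = t ^ 2 / (ε * a) := by
    rw [hc_def]; field_simp; ring
  linarith [e ▸ h2]

end Summit.AtomisticToContinuum.FouriersLaw.Cruxes.VanishingNoiseBound.StieltjesNoiseThreshold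

end
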